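import Summits.QuantumAdvantage.QuantumAdvantage.Theorems.SosSandwichPseudoBoundedClosure
import Summits.QuantumAdvantage.QuantumAdvantage.Theorems.SosSandwichTransferPBQueryHalfPB
import HarnessLib

/-!
# Crux `PseudoBoundedAA` (stmt-QuantumAdvantage-15237, route SosSandwich), line `birth` — the level-descent stub is IMPLIED by the crux (calibration)

The registered skeleton `Cruxes/PseudoBoundedAA/Lines/birth.lean` closes the crux `PseudoBoundedAA` from
`stub_homogeneousRung` (= the route item `HomogeneousPBAA`) and `stub_levelDescent` ("every `p ∈ K_T` with
`Var ≥ ε` has a surrogate `q` in a flat base class — `T' = 1` or top-homogeneous — with `Var[q] ≥ A(ε/T)^a` and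
influences dominated by `B ×` influences of `p`"), using the PROVED one-query rung. This file proves the
CONVERSE calibration: `PseudoBoundedAA → stub_levelDescent` (with `T' = 1`, `N' = 1`, `B = 1`, `a = c`,
`A = min(1,C)/4`), by the one-bit surrogate `q = l·X₀ + (1−l)/2 ∈ K_1` (`Var[q] = l²/4`, `Inf₀[q] = l²`,
`l² = min(1, C(ε/T)^c)`). Hence, GIVEN the landed `OneQueryFrameAA`, the stub `stub_levelDescent` is
EQUIVALENT to the crux itself — evidence for the planner that the line's load-bearing stub is crux-sized
(promote-stub / re-line), not a weakness of the crux.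

* `evalBool_oneBitMix`, `boolAvg_oneBitMix`, `boolVariance_oneBitMix`, `influence_oneBitMix` — the surrogate's
  cube statistics;
* **`levelDescent_of_pseudoBoundedAA`** — the statement of `stub_levelDescent` (tree vocabulary:
  `PseudoBounded`, `boolVariance`, `influence`, definitionally the skeleton's `PseudoBounded`/`cvar`/`infl`) from
  `PseudoBoundedAA` by name.

All proved; no named fact. Source: the route file `Theses/SosSandwich.lean` (TWO-LAYER PLAN) and the skeleton's
own remark "it is moreover a CONSEQUENCE of PB-AA (surrogate `1/2 + δχ₀χ₁ ∈ K_1`)"; folklore cube algebra.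
-/

-- D-0017: single-conjunct summit ⇒ the duplicate `QuantumAdvantage.QuantumAdvantage` is mandated.
set_option linter.dupNamespace false

noncomputable section

namespace Summit.QuantumAdvantage.QuantumAdvantage.Cruxes.PseudoBoundedAA.Birth

open MvPolynomial Finset Literature.Computability.QuantumComplexity
open Summit.QuantumAdvantage.QuantumAdvantage.Theses.SosSandwich
open Summit.QuantumAdvantage.QuantumAdvantage.Theorems.SosSandwich

/-! ### The one-bit surrogate `l·X₀ + (1−l)·(1/2)` -/

/-- Values of the surrogate on the one-bit cube. [folklore] -/
theorem evalBool_oneBitMix (l : ℝ) (x : Fin 1 → Bool) :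
    evalBool (C l * X 0 + C (1 - l) * C (1 / 2 : ℝ) : MvPolynomial (Fin 1) ℝ) x =
      l * (if x 0 then 1 else 0) + (1 - l) / 2 := by
  simp [evalBool]
  ring

/-- Mean of the surrogate: `1/2`. [folklore] -/
theorem boolAvg_oneBitMix (l : ℝ) :
    boolAvg (evalBool (C l * X 0 + C (1 - l) * C (1 / 2 : ℝ) : MvPolynomial (Fin 1) ℝ)) = 1 / 2 := by
  unfold boolAvg
  rw [sum_cube_one]
  simp only [evalBool_oneBitMix]
  norm_num
  ring

/-- Variance of the surrogate: `l²/4`. [folklore] -/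
theorem boolVariance_oneBitMix (l : ℝ) :
    boolVariance (C l * X 0 + C (1 - l) * C (1 / 2 : ℝ) : MvPolynomial (Fin 1) ℝ) = l ^ 2 / 4 := by
  unfold boolVariance
  rw [boolAvg_oneBitMix]
  unfold boolAvg
  rw [sum_cube_one]
  simp only [evalBool_oneBitMix]
  norm_num
  ring

/-- Influence of the surrogate's only variable: `l²`. [folklore] -/
theorem influence_oneBitMix (l : ℝ) (i : Fin 1) :
    influence i (C l * X 0 + C (1 - l) * C (1 / 2 : ℝ) : MvPolynomial (Fin 1) ℝ) = l ^ 2 := by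
  have hi : i = 0 := Subsingleton.elim _ _
  subst hi
  unfold influence boolAvg
  rw [sum_cube_one]
  simp only [evalBool_oneBitMix, flipBit, Function.update_self]
  norm_num

/-- The surrogate lies in `K_1` for `l ∈ [0,1]` (convex combination of the dictator and the constant `1/2`).
[folklore] -/
theorem pseudoBounded_oneBitMix {l : ℝ} (h0 : 0 ≤ l) (h1 : l ≤ 1) :
    PseudoBounded 1 (C l * X 0 + C (1 - l) * C (1 / 2 : ℝ) : MvPolynomial (Fin 1) ℝ) :=
  Summit.QuantumAdvantage.QuantumAdvantage.Theorems.SosSandwich.PseudoBounded.convexComb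
    (pseudoBounded_X 0 le_rfl) (pseudoBounded_C (by norm_num) (by norm_num) 1) h0 h1

/-! ### The calibration -/

/-- **`PseudoBoundedAA` implies the level-descent stub.** Granted PB-AA with constants `(c, C)`: every
`p ∈ K_T` (`T ≥ 1`) with `Var[p] ≥ ε > 0` has the one-bit surrogate `q = l·X₀ + (1−l)/2 ∈ K_1`,
`l² = min(1, C(ε/T)^c)`, with `Var[q] = l²/4 ≥ (min(1,C)/4)·(ε/T)^c` and `Inf₀[q] = l² ≤ Inf_{i'}[p]` for the
PB-AA–influential variable `i'` of `p`. This is the statement of the registered stub `stub_levelDescent` (with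
`a = c`, `A = min(1,C)/4`, `B = 1`, base class `T' = 1`), in the tree's vocabulary. [folklore] -/
theorem levelDescent_of_pseudoBoundedAA (h : PseudoBoundedAA) :
    ∃ (a : ℕ) (A B : ℝ), 0 < A ∧ 0 < B ∧
      ∀ (N T : ℕ) (p : MvPolynomial (Fin N) ℝ) (ε : ℝ), 1 ≤ T → PseudoBounded T p → 0 < ε →
        ε ≤ boolVariance p →
        ∃ (N' T' : ℕ) (q : MvPolynomial (Fin N') ℝ), 1 ≤ T' ∧ T' ≤ T ∧ PseudoBounded T' q ∧
          (T' = 1 ∨ (∀ x : Fin N' → Bool, ∑ i : Fin N', (evalBool q x - evalBool q (Function.update x i (!x i))) =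
            4 * (T' : ℝ) * (evalBool q x - boolAvg (evalBool q)))) ∧
          A * (ε / T) ^ a ≤ boolVariance q ∧
          ∀ i : Fin N', ∃ i' : Fin N, influence i q ≤ B * influence i' p := by
  obtain ⟨c, C₀, hC₀, H⟩ := Cruxes.TransferPB.Birth.SimTreePB.pbInfluenceBound_of_pseudoBoundedAA h
  refine ⟨c, min 1 C₀ / 4, 1, by positivity, one_pos, fun N T p ε hT hp hε hv => ?_⟩
  obtain ⟨i', hi'⟩ := H N T p ε hT hp hε hv
  -- the size of the surrogate's bias
  set s : ℝ := (ε / T) ^ c with hs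
  have hTpos : (0 : ℝ) < T := by exact_mod_cast hT
  have hεT1 : ε / T ≤ 1 := by
    rw [div_le_one hTpos]
    have h4 := boolVariance_le_quarter hp
    have hT1 : (1 : ℝ) ≤ T := by exact_mod_cast hT
    linarith
  have hs0 : 0 ≤ s := by positivity
  have hs1 : s ≤ 1 := pow_le_one₀ (by positivity) hεT1
  set m : ℝ := min 1 (C₀ * s) with hm
  have hm0 : 0 ≤ m := le_min zero_le_one (by positivity)
  have hm1 : m ≤ 1 := min_le_left _ _
  set l : ℝ := Real.sqrt m with hl
  have hl0 : 0 ≤ l := Real.sqrt_nonneg _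
  have hl1 : l ≤ 1 := by rw [hl, ← Real.sqrt_one]; exact Real.sqrt_le_sqrt hm1
  have hl2 : l ^ 2 = m := Real.sq_sqrt hm0
  refine ⟨1, 1, C l * X 0 + C (1 - l) * C (1 / 2 : ℝ), le_rfl, hT, pseudoBounded_oneBitMix hl0 hl1,
    Or.inl rfl, ?_, fun i => ⟨i', ?_⟩⟩
  · -- variance: `min(1,C)/4 · s ≤ m/4 = l²/4`
    rw [boolVariance_oneBitMix, hl2]
    have hkey : min 1 C₀ * s ≤ m := by
      rcases le_total (C₀ * s) 1 with hle | hge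
      · rw [hm, min_eq_right hle]
        exact mul_le_mul_of_nonneg_right (min_le_right _ _) hs0
      · rw [hm, min_eq_left hge]
        calc min 1 C₀ * s ≤ 1 * s := mul_le_mul_of_nonneg_right (min_le_left _ _) hs0
          _ ≤ 1 := by rw [one_mul]; exact hs1
    have : min 1 C₀ / 4 * s = (min 1 C₀ * s) / 4 := by ring
    rw [this]
    linarith
  · -- influence domination: `Inf[q] = l² = m ≤ C s ≤ Inf_{i'}[p]`
    rw [influence_oneBitMix, hl2, one_mul]
    exact (min_le_right _ _).trans hi'

end Summit.QuantumAdvantage.QuantumAdvantage.Cruxes.PseudoBoundedAA.Birth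

end
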